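import Literature.NumberTheory.LFunctions.StarkExceptionalZeroProofs
import HarnessLib

/-!
# Hoffstein 1980 Lemma 2 = Ji–Lu 2004 Lemma 1 = Chen 2007 Lemma 1: at most one real zero `β` of
# `ζ_K` (`K ≠ ℚ`) with `1 − β < (6 − 4√2)/log d_K`, and it is simple — PROVED

Topic `Literature/NumberTheory/LFunctions` (namespace `Literature.NumberTheory.LFunctions`; helper
lemmas in the grouping sub-namespace `NumberField`, as in the Stark files). PROOF-ONLY module
(D-0014/D-0026, kernel lane): theorems, no definitions, no named facts. Cell `landau-siegel` §C
(typer pool), proof-kind OFFER-B 2026-08-27.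

## The statement (read on the page)

* [Chen2007SiegelTatuzawaHoffstein, Lemma 1 p. 362]: "**Lemma 1** (Hoffstein [5, Lemma 2]). Let
  `c = 6 − 4√2`. Let `K (≠ ℚ)` be an algebraic number field and let `d_K` denote the absolute value of
  the discriminant of `K`. Then `ζ_K(s)` has at most one real simple zero `β` with `1 − β < c/log d_K`."
* [JiLu2004LOneLowerBound, Lemma 1 p. 406]: "**Lemma 1** ([6, Lemma 2]). Set `c = (3 + 2√2)/2` and
  let `d_F` denote the absolute value of the discriminant of a number field `F ≠ ℚ`. Then `ζ_F(s)` has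
  at most one real zero `β` with `β > 1 − 1/(c log d_F)`, and if it exists it is a simple zero."
* [Hoffstein1980SiegelTatuzawa, Lemma 2 p. 169] prints the same window with the decimal `2.9142`:
  "`ζ_K(s)` has at most one real simple zero `β` with `1 − β < 1/(2.9142 log|D_K|)`" — typed verbatim
  (with `2.9142`) as the named fact `hoffstein1980_lemma2` in `SiegelTatuzawaExplicit.lean`.

The three constants are one number: `6 − 4√2 = 2/(3 + 2√2) = 1/(3/2 + √2) = 0.343 145 75…`,
`3/2 + √2 = 2.914 213 56…` (`chenConst_eq_two_div`, `chenConst_eq_inv`, `hoffsteinConst_bounds`).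
READING NOTE on the printed decimal: `2.9142 < 3/2 + √2`, so `1/(2.9142 log d) > (6 − 4√2)/log d`:
the window of `hoffstein1980_lemma2` as typed is wider, by the factor `1.000 004 6…`, than the window
Hoffstein's argument (Stark's inequality, below) delivers; the theorem proved here is the
exact-constant statement of Ji–Lu and Chen, which is what that argument proves. (Nothing is edited in
the fact; this module does not import it.)

Rendering, as for the tree's `NumberField.Stark1974_atMostOneZero` (`StarkExceptionalZero.lean`):
typed on the entire `ζ₁_K(s) = (s − 1)ζ_K(s)` (`dedekindZeta₁`, same zeros and multiplicities as
`ζ_K`); "at most one real zero … and if it exists it is simple" = the real zeros `β` in the window form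
a subsingleton AND each has `analyticOrderAt (ζ₁_K) β = 1` (the proof rules out two distinct real
zeros as well as one multiple real zero). `K ≠ ℚ` = `1 < finrank ℚ K` (`chen2007_lemma1`,
`jiLu2004_lemma1`); the hypothesis-free variant `chen2007_lemma1'` covers degree one vacuously
(`d_K = 1`, `log 1 = 0`, Lean's `x/0 = 0`: the window `1 − β < 0` contains no zero since
`ζ₁_K(s) ≠ 0` for `Re s ≥ 1`) — this is the shape of `hoffstein1980_lemma2`, with the exact constant.

## The proof (Hoffstein p. 170, as formalised)

Hoffstein: "by Stark's Lemma 3, `Σ_{ρ ∈ S} 1/(σ − ρ) < 1/(σ − 1) + ½ log|D_K|` … two real zeros in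
the range force …". The tree PROVES Stark's inequality for `[K:ℚ] ≥ 2`, `1 < σ ≤ 2`:
`Re 1/(σ−ρ₁) + Re 1/(σ−ρ₂) ≤ 1/(σ−1) + ½ log d_K` for two distinct zeros with `Re ρᵢ > 0`
(`NumberField.stark_re_inv_sub_add_le`) and `2 Re 1/(σ−ρ) ≤ 1/(σ−1) + ½ log d_K` for a zero of order
`≥ 2` (`NumberField.stark_two_mul_re_inv_sub_le`), both in `StarkExceptionalZeroProofs.lean`. Put
`L = log d_K (> 1)`, `c = 6 − 4√2`, `y = 2√2 − 2` and `σ₀ = 1 + y/L ∈ (1, 2]`. A real zero `β` with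
`1 − β < c/L` has `0 < σ₀ − β < (y + c)/L`, so `1/(σ₀ − β) > L/(y + c)`; two of them (or one double)
give `2L/(y + c) < 1/(σ₀ − 1) + L/2 = L/y + L/2`. But `y` is the double root of
`y² − (2 − c)y + 2c = 0` (`c = 6 − 4√2` is exactly the largest `c` for which this quadratic has a
real root — the optimality of Hoffstein's constant), which says `2/(y + c) = 1/y + 1/2`:
contradiction (`hoffstein_quadratic`, `hoffstein_rhs_eq`).

«The programme SEARCHES and TYPES; no claim about Landau–Siegel zeros, Theorems 1–2 of
arXiv:2211.02515 or a repaired Margin232 until a kernel theorem says so.»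

## References

* [Hoffstein1980SiegelTatuzawa] J. Hoffstein, *On the Siegel–Tatuzawa theorem*, Acta Arith. 38
  (1980) 167–174 — Lemma 2 p. 169, proof p. 170.
* [JiLu2004LOneLowerBound] C.-G. Ji, H.-W. Lu, *Lower bound of real primitive L-function at s = 1*,
  Acta Arith. 111 (2004) 405–409 — Lemma 1 p. 406 (held: `paper:doi-10-4064-aa111-4-2` p0002).
* [Chen2007SiegelTatuzawaHoffstein] Y.-G. Chen, *On the Siegel–Tatuzawa–Hoffstein theorem*, Acta
  Arith. 130 (2007) 361–367 — Lemma 1 p. 362 (held: `paper:doi-10-4064-aa130-4-5` p0002).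
* [Stark1974] H. M. Stark, *Some effective cases of the Brauer–Siegel theorem*, Invent. Math. 23
  (1974) 135–152 — Lemma 3 (the inequality; tree: `StarkExceptionalZeroProofs.lean`).
-/

noncomputable section

open scoped NumberField
open Complex Set NumberField

namespace Literature.NumberTheory.LFunctions

namespace NumberField

variable {K : Type*} [Field K] [NumberField K]

/-! ### The constant `c = 6 − 4√2 = 2/(3 + 2√2) = 1/(3/2 + √2)` -/

/-- `1.414213 < √2 < 1.414214`. [folklore] -/
private theorem sqrt_two_bounds : (1.414213 : ℝ) < Real.sqrt 2 ∧ Real.sqrt 2 < 1.414214 := by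
  constructor
  · rw [Real.lt_sqrt (by norm_num)]; norm_num
  · rw [Real.sqrt_lt' (by norm_num)]; norm_num

/-- Chen's `c = 6 − 4√2` is Ji–Lu's `1/c′`, `c′ = (3 + 2√2)/2`: `6 − 4√2 = 2/(3 + 2√2)`.
[cite: Chen2007SiegelTatuzawaHoffstein, Lemma 1 p. 362] [cite: JiLu2004LOneLowerBound, Lemma 1 p. 406] -/
theorem chenConst_eq_two_div : (6 : ℝ) - 4 * Real.sqrt 2 = 2 / (3 + 2 * Real.sqrt 2) := by
  have hs : Real.sqrt 2 * Real.sqrt 2 = 2 := Real.mul_self_sqrt (by norm_num)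
  have hpos : (0 : ℝ) < 3 + 2 * Real.sqrt 2 := by positivity
  rw [eq_div_iff hpos.ne']
  linear_combination (-8 : ℝ) * hs

/-- … and Hoffstein's `1/(3/2 + √2)`: `6 − 4√2 = 1/(3/2 + √2)`.
[cite: Hoffstein1980SiegelTatuzawa, Lemma 2 p. 169] [cite: Chen2007SiegelTatuzawaHoffstein, Lemma 1 p. 362] -/
theorem chenConst_eq_inv : (6 : ℝ) - 4 * Real.sqrt 2 = 1 / (3 / 2 + Real.sqrt 2) := by
  rw [chenConst_eq_two_div]
  have hpos : (0 : ℝ) < 3 + 2 * Real.sqrt 2 := by positivity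
  field_simp

/-- The printed decimal: `2.9142 < 3/2 + √2 < 2.9143` (Hoffstein prints `1/(2.9142 log|D_K|)`; the
exact reciprocal constant is `3/2 + √2 = 2.914 213…`, so the printed window is the wider one).
[cite: Hoffstein1980SiegelTatuzawa, Lemma 2 p. 169] -/
theorem hoffsteinConst_bounds : (2.9142 : ℝ) < 3 / 2 + Real.sqrt 2 ∧ 3 / 2 + Real.sqrt 2 < 2.9143 := by
  obtain ⟨h1, h2⟩ := sqrt_two_bounds
  constructor <;> linarith

/-- `0.34314 < 6 − 4√2 < 0.34315`. [cite: Chen2007SiegelTatuzawaHoffstein, Lemma 1 p. 362] -/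
theorem chenConst_bounds : (0.34314 : ℝ) < 6 - 4 * Real.sqrt 2 ∧ 6 - 4 * Real.sqrt 2 < 0.34315 := by
  obtain ⟨h1, h2⟩ := sqrt_two_bounds
  constructor <;> linarith

/-! ### Hoffstein's numerics at `σ₀ = 1 + (2√2 − 2)/log d_K` -/

/-- `y = 2√2 − 2` is the double root of `y² − (2 − c)y + 2c`, `c = 6 − 4√2`.
[cite: Hoffstein1980SiegelTatuzawa, proof of Lemma 2 p. 170] -/
theorem hoffstein_quadratic :
    (2 * Real.sqrt 2 - 2) * (2 * Real.sqrt 2 - 2) + (6 - 4 * Real.sqrt 2 - 2) * (2 * Real.sqrt 2 - 2) +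
      2 * (6 - 4 * Real.sqrt 2) = 0 := by
  have hs : Real.sqrt 2 * Real.sqrt 2 = 2 := Real.mul_self_sqrt (by norm_num)
  linear_combination (-4 : ℝ) * hs

/-- Consequently Stark's right-hand side at `σ₀ = 1 + y/L` equals twice the per-zero lower bound:
`L/y + L/2 = 2L/(y + c)`. [cite: Hoffstein1980SiegelTatuzawa, proof of Lemma 2 p. 170] -/
theorem hoffstein_rhs_eq (L : ℝ) :
    L / (2 * Real.sqrt 2 - 2) + L / 2 = 2 * L / (2 * Real.sqrt 2 - 2 + (6 - 4 * Real.sqrt 2)) := by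
  obtain ⟨h1, h2⟩ := sqrt_two_bounds
  have hy : (0 : ℝ) < 2 * Real.sqrt 2 - 2 := by linarith
  have hyc : (0 : ℝ) < 2 * Real.sqrt 2 - 2 + (6 - 4 * Real.sqrt 2) := by linarith
  rw [div_add_div _ _ hy.ne' two_ne_zero, div_eq_div_iff (mul_ne_zero hy.ne' two_ne_zero) hyc.ne']
  linear_combination L * hoffstein_quadratic

/-- `Re 1/(σ − β) = 1/(σ − β)` for real `σ, β`. [folklore] -/
private theorem re_inv_ofReal_sub (σ β : ℝ) : (((σ : ℂ) - (β : ℂ))⁻¹).re = 1 / (σ - β) := by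
  rw [← ofReal_sub, ← ofReal_inv, ofReal_re, one_div]

/-! ### The lemma for `[K:ℚ] ≥ 2` -/

/-- **Hoffstein's Lemma 2 with the exact constant (= Chen 2007 Lemma 1 = Ji–Lu 2004 Lemma 1), for a
number field `K` of degree `≥ 2`:** the real zeros `β` of `ζ₁_K = (s−1)ζ_K` with
`1 − β < (6 − 4√2)/log d_K` form a subsingleton, and each is a simple zero. Proof = Hoffstein's
(p. 170) on the tree's proved Stark inequalities, at `σ₀ = 1 + (2√2 − 2)/log d_K`.
[cite: Chen2007SiegelTatuzawaHoffstein, Lemma 1 p. 362] [cite: JiLu2004LOneLowerBound, Lemma 1 p. 406]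
[cite: Hoffstein1980SiegelTatuzawa, Lemma 2 p. 169, proof p. 170] -/
theorem dedekindZeta₁_realZero_hoffsteinWindow (hn : 1 < Module.finrank ℚ K) :
    {β : ℝ | dedekindZeta₁ K β = 0 ∧
        1 - β < (6 - 4 * Real.sqrt 2) / Real.log ((discr K).natAbs : ℝ)}.Subsingleton ∧
      ∀ β : ℝ, dedekindZeta₁ K β = 0 →
        1 - β < (6 - 4 * Real.sqrt 2) / Real.log ((discr K).natAbs : ℝ) →
          analyticOrderAt (dedekindZeta₁ K) β = 1 := by
  obtain ⟨hs1, hs2⟩ := sqrt_two_bounds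
  have hrhs := hoffstein_rhs_eq
  set d : ℝ := ((discr K).natAbs : ℝ) with hd
  set L : ℝ := Real.log d with hL
  set s : ℝ := Real.sqrt 2 with hs
  set c : ℝ := 6 - 4 * s with hc
  set y : ℝ := 2 * s - 2 with hy
  have hd3 : (3 : ℝ) ≤ d := by
    have h := NumberField.abs_discr_gt_two hn
    rw [Int.abs_eq_natAbs] at h
    have h3 : 3 ≤ (discr K).natAbs := by omega
    rw [hd]
    exact_mod_cast h3
  have hL1 : 1 < L := by
    rw [hL, Real.lt_log_iff_exp_lt (by linarith)]
    linarith [Real.exp_one_lt_d9]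
  have hL0 : 0 < L := by linarith
  have hc0 : 0 < c := by rw [hc]; linarith
  have hc1 : c < 0.35 := by rw [hc]; linarith
  have hy0 : 0 < y := by rw [hy]; linarith
  have hy1 : y < 1 := by rw [hy]; linarith
  have hyc : 0 < y + c := by linarith
  set σ₀ : ℝ := 1 + y / L with hσ₀
  have hyL : 0 < y / L := div_pos hy0 hL0
  have hyL1 : y / L < 1 := by rw [div_lt_one hL0]; linarith
  have hσ₀1 : 1 < σ₀ := by rw [hσ₀]; linarith
  have hσ₀2 : σ₀ ≤ 2 := by rw [hσ₀]; linarith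
  -- Stark's right-hand side at `σ₀`
  have hRHS : 1 / (σ₀ - 1) + L / 2 = 2 * L / (y + c) := by
    have h1 : σ₀ - 1 = y / L := by rw [hσ₀]; ring
    rw [h1, one_div_div]
    exact hrhs L
  -- each real zero in the window: `Re 1/(σ₀ − β) > L/(y + c)` and `Re β > 0`
  have hlow : ∀ β : ℝ, dedekindZeta₁ K β = 0 → 1 - β < c / L →
      L / (y + c) < (((σ₀ : ℂ) - (β : ℂ))⁻¹).re ∧ 0 < (β : ℂ).re := by
    intro β hβ hw
    have hβ1 : β < 1 := by
      by_contra h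
      have h1 : (1 : ℝ) ≤ (β : ℂ).re := by rw [ofReal_re]; linarith
      exact dedekindZeta₁_ne_zero_of_one_le_re h1 hβ
    have hcL : c / L ≤ c := div_le_self hc0.le hL1.le
    have hβ0 : 0 < β := by linarith
    refine ⟨?_, by rw [ofReal_re]; exact hβ0⟩
    rw [re_inv_ofReal_sub]
    have hpos : 0 < σ₀ - β := by linarith
    have hlt : σ₀ - β < (y + c) / L := by
      rw [add_div, hσ₀]
      linarith
    calc L / (y + c) = 1 / ((y + c) / L) := by rw [one_div_div]
      _ < 1 / (σ₀ - β) := one_div_lt_one_div_of_lt hpos hlt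
  refine ⟨?_, ?_⟩
  · -- at most one real zero in the window
    intro β₁ h₁ β₂ h₂
    by_contra hne
    have hne' : (β₁ : ℂ) ≠ (β₂ : ℂ) := fun h => hne (by exact_mod_cast h)
    obtain ⟨hl₁, hp₁⟩ := hlow β₁ h₁.1 h₁.2
    obtain ⟨hl₂, hp₂⟩ := hlow β₂ h₂.1 h₂.2
    have hS := stark_re_inv_sub_add_le hn hσ₀1 hσ₀2 h₁.1 h₂.1 hp₁ hp₂ hne'
    rw [hRHS] at hS
    have h2 : 2 * L / (y + c) = L / (y + c) + L / (y + c) := by ring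
    linarith
  · -- a real zero in the window is simple
    intro β hβ hw
    obtain ⟨hl, hp⟩ := hlow β hβ hw
    have h1 : ((1 : ℕ) : ℕ∞) ≤ analyticOrderAt (dedekindZeta₁ K) β :=
      one_le_analyticOrderAt_dedekindZeta₁ hβ
    have hne_top := analyticOrderAt_dedekindZeta₁_ne_top (K := K) (β : ℂ)
    by_contra hne1
    have h2 : (2 : ℕ∞) ≤ analyticOrderAt (dedekindZeta₁ K) β := by
      obtain ⟨k, hk⟩ := ENat.ne_top_iff_exists.mp hne_top
      rw [← hk] at h1 hne1 ⊢
      have hk1 : 1 ≤ k := by exact_mod_cast h1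
      have hk1' : k ≠ 1 := fun h ↦ hne1 (by rw [h]; rfl)
      have hk2 : 2 ≤ k := by omega
      exact_mod_cast hk2
    have hS := stark_two_mul_re_inv_sub_le hn hσ₀1 hσ₀2 hp h2
    rw [hRHS] at hS
    have h2' : 2 * L / (y + c) = L / (y + c) + L / (y + c) := by ring
    linarith

/-- A number field of degree one has discriminant `1` (it is `ℚ`-isomorphic to `ℚ`, and
`d_ℚ = 1`). [folklore] -/
private theorem discr_eq_one_of_finrank_eq_one (h1 : Module.finrank ℚ K = 1) : discr K = 1 := by
  have hbij : Function.Bijective (algebraMap ℚ K) :=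
    Algebra.finrank_eq_one_iff_bijective_algebraMap.mp h1
  have e : ℚ ≃ₐ[ℚ] K := AlgEquiv.ofBijective (Algebra.ofId ℚ K) hbij
  exact (NumberField.discr_eq_discr_of_algEquiv ℚ e).symm.trans NumberField.discr_rat

end NumberField

open NumberField

/-- **Chen 2007, Lemma 1 (= Hoffstein 1980 Lemma 2 = Ji–Lu 2004 Lemma 1), PROVED.** "Let
`c = 6 − 4√2`. Let `K (≠ ℚ)` be an algebraic number field and let `d_K` denote the absolute value
of the discriminant of `K`. Then `ζ_K(s)` has at most one real simple zero `β` with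
`1 − β < c/log d_K`." Rendered on the entire `ζ₁_K = (s−1)ζ_K` (same zeros and multiplicities as
`ζ_K`): for `[K:ℚ] ≥ 2`, the real zeros in the window form a subsingleton and each has analytic order
`1`. Proof: Hoffstein's, on the tree's proved Stark inequalities
(`NumberField.dedekindZeta₁_realZero_hoffsteinWindow`).
[cite: Chen2007SiegelTatuzawaHoffstein, Lemma 1 p. 362] [cite: Hoffstein1980SiegelTatuzawa, Lemma 2 p. 169] -/
theorem chen2007_lemma1 (K : Type) [Field K] [NumberField K] (hK : 1 < Module.finrank ℚ K) :
    {β : ℝ | dedekindZeta₁ K β = 0 ∧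
        1 - β < (6 - 4 * Real.sqrt 2) / Real.log ((NumberField.discr K).natAbs : ℝ)}.Subsingleton ∧
      ∀ β : ℝ, dedekindZeta₁ K β = 0 →
        1 - β < (6 - 4 * Real.sqrt 2) / Real.log ((NumberField.discr K).natAbs : ℝ) →
          analyticOrderAt (dedekindZeta₁ K) β = 1 :=
  dedekindZeta₁_realZero_hoffsteinWindow hK

/-- **Ji–Lu 2004, Lemma 1 (= Hoffstein 1980 Lemma 2), PROVED.** "Set `c = (3 + 2√2)/2` and let `d_F`
denote the absolute value of the discriminant of a number field `F ≠ ℚ`. Then `ζ_F(s)` has at most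
one real zero `β` with `β > 1 − 1/(c log d_F)`, and if it exists it is a simple zero." Same rendering;
from `chen2007_lemma1` by `6 − 4√2 = 2/(3 + 2√2)` (`NumberField.chenConst_eq_two_div`).
[cite: JiLu2004LOneLowerBound, Lemma 1 p. 406] [cite: Hoffstein1980SiegelTatuzawa, Lemma 2 p. 169] -/
theorem jiLu2004_lemma1 (F : Type) [Field F] [NumberField F] (hF : 1 < Module.finrank ℚ F) :
    {β : ℝ | dedekindZeta₁ F β = 0 ∧
        1 - 1 / ((3 + 2 * Real.sqrt 2) / 2 * Real.log ((NumberField.discr F).natAbs : ℝ)) < β}.Subsingleton ∧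
      ∀ β : ℝ, dedekindZeta₁ F β = 0 →
        1 - 1 / ((3 + 2 * Real.sqrt 2) / 2 * Real.log ((NumberField.discr F).natAbs : ℝ)) < β →
          analyticOrderAt (dedekindZeta₁ F) β = 1 := by
  obtain ⟨hsub, hsimple⟩ := chen2007_lemma1 F hF
  have hconv : ∀ β : ℝ,
      1 - 1 / ((3 + 2 * Real.sqrt 2) / 2 * Real.log ((NumberField.discr F).natAbs : ℝ)) < β →
        1 - β < (6 - 4 * Real.sqrt 2) / Real.log ((NumberField.discr F).natAbs : ℝ) := by
    intro β h
    have hpos : (0 : ℝ) < 3 + 2 * Real.sqrt 2 := by positivity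
    have heq : 1 / ((3 + 2 * Real.sqrt 2) / 2 * Real.log ((NumberField.discr F).natAbs : ℝ)) =
        (6 - 4 * Real.sqrt 2) / Real.log ((NumberField.discr F).natAbs : ℝ) := by
      rw [chenConst_eq_two_div, one_div, mul_inv, inv_div, ← div_eq_mul_inv]
    rw [← heq]
    linarith
  exact ⟨fun β₁ h₁ β₂ h₂ => hsub ⟨h₁.1, hconv β₁ h₁.2⟩ ⟨h₂.1, hconv β₂ h₂.2⟩,
    fun β hβ hw => hsimple β hβ (hconv β hw)⟩

/-- **The hypothesis-free form (the shape of `hoffstein1980_lemma2`, with the exact constant).** For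
EVERY number field `K`: the real zeros `β` of `ζ₁_K` with `1 − β < (6 − 4√2)/log d_K` form a
subsingleton and each is simple. For `[K:ℚ] ≥ 2` this is `chen2007_lemma1`; in degree one `d_K = 1`,
`log d_K = 0` and (Lean's `x/0 = 0`) the window `1 − β < 0` holds no zero at all, since
`ζ₁_K(s) ≠ 0` for `Re s ≥ 1`. [cite: Chen2007SiegelTatuzawaHoffstein, Lemma 1 p. 362]
[cite: Hoffstein1980SiegelTatuzawa, Lemma 2 p. 169] -/
theorem chen2007_lemma1' (K : Type) [Field K] [NumberField K] :
    {β : ℝ | dedekindZeta₁ K β = 0 ∧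
        1 - β < (6 - 4 * Real.sqrt 2) / Real.log ((NumberField.discr K).natAbs : ℝ)}.Subsingleton ∧
      ∀ β : ℝ, dedekindZeta₁ K β = 0 →
        1 - β < (6 - 4 * Real.sqrt 2) / Real.log ((NumberField.discr K).natAbs : ℝ) →
          analyticOrderAt (dedekindZeta₁ K) β = 1 := by
  by_cases hn : 1 < Module.finrank ℚ K
  · exact chen2007_lemma1 K hn
  · have h1 : Module.finrank ℚ K = 1 := by
      have h0 : 0 < Module.finrank ℚ K := Module.finrank_pos
      omega
    have hdK : NumberField.discr K = 1 := NumberField.discr_eq_one_of_finrank_eq_one h1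
    have hlog : Real.log ((NumberField.discr K).natAbs : ℝ) = 0 := by rw [hdK]; simp
    have hempty : ∀ β : ℝ, dedekindZeta₁ K β = 0 →
        ¬ 1 - β < (6 - 4 * Real.sqrt 2) / Real.log ((NumberField.discr K).natAbs : ℝ) := by
      intro β hβ hw
      rw [hlog, div_zero] at hw
      have h1' : (1 : ℝ) ≤ (β : ℂ).re := by rw [ofReal_re]; linarith
      exact dedekindZeta₁_ne_zero_of_one_le_re h1' hβ
    exact ⟨fun β₁ h₁ β₂ h₂ => absurd h₁.2 (hempty β₁ h₁.1),
      fun β hβ hw => absurd hw (hempty β hβ)⟩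

end Literature.NumberTheory.LFunctions
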